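import Literature.Geometry.Lorentzian.TeukolskyWronskianBoundProofs
import Literature.Geometry.Lorentzian.TeukolskyOutgoingExpansion
import Literature.Geometry.Lorentzian.KerrSurfaceGravity
import Literature.Geometry.Lorentzian.KerrSeparatedPotential

/-!
# The Wronskian lower bound is the end-point case of the cone Green-kernel bound
# (stub `stub_wronskianOfKernel`, S4′ of the line `olver-dunster-uniform-reduction`)

Crux `PhaseMixingCapture.KappaExplicitWaveDecay` (stmt-FinalStateConjecture-10654), line
`olver-dunster-uniform-reduction`, stub S4′. The kernel bound (hypothesis) controls
`√(r²+a²)|R_𝓗(r)| · √(r′²+a²)|R_𝓘(r′)| ≤ C|m|^N κ^{-N} |𝔚(r)|` for `r₊ < r ≤ r′` beyond a collar of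
blown-up depth `θ`; the Wronskian bound (conclusion) is `1 ≤ (C|m|^N κ^{-N})² |𝔚(r)|²` at every
`r > r₊`, with the SAME constants (take `θ = 1`). Three facts about the normalisations of
Teixeira da Costa's Def. 2.3 (`s = 0`) and nothing else:

* the Wronskian `𝔚 = Δ(R_𝓗 R_𝓘′ − R_𝓘 R_𝓗′)` of two radial solutions is constant on `(r₊, ∞)`
  (`Kerr.Costa2019.radialWronskian_eq`, TdC Remark 5.1);
* `√(r²+a²)‖R_𝓗 r‖ → 1` as `r → r₊⁺` (`tendsto_horizonNormalisation`): near `r₊`,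
  `R_𝓗(r)(r − r₊)^{−ξ} = f(r)` with `f` smooth at `r₊`, `‖f(r₊)‖√(r₊²+a²) = 1`, and the horizon
  exponent `ξ = Kerr.horizonExponent` is purely imaginary, so `‖(r − r₊)^{−ξ}‖ = 1`;
* `r′‖R_𝓘 r′‖ → 1` as `r′ → ∞` (`tendsto_infinityNormalisation`): the `N = 1` outgoing expansion
  `R_𝓘 = e^{iωr′ + 2iMω log r′}(c₀/r′ + c₁/r′²) + O(r′⁻³)` with `|c₀| = 1` and a unimodular phase;
  and `r′ ≤ √(r′²+a²)`.

Letting first `r → r₊⁺` and then `r′ → ∞` in the kernel bound (`one_le_of_kernelBound`) gives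
`1 ≤ C|m|^N κ^{-N}|𝔚|`, which is squared. Pure limits; no named fact is used. The two auxiliary
limits `t·t^q → 0` (`q < −1`) and `t·π_N(t) → c₀` are adapted from
`Literature/Geometry/Lorentzian/TeukolskyRadialFluxInfinity.lean`.
-/

-- the doubled `FinalStateConjecture.FinalStateConjecture` path component trips dupNamespace
set_option linter.dupNamespace false

noncomputable section

namespace Summit.FinalStateConjecture.FinalStateConjecture.Theorems.KappaExplicitWaveDecay.OlverDunsterUniformReduction

open Literature.Geometry.Lorentzian
open MeasureTheory Filter Set Complex
open scoped Topology

/-! ### End-point limits in a two-variable bound -/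

/-- **End-point limits in a two-variable bound.** If `g → 1` as `r → x₀⁺`, `u → 1` at `+∞`,
`u ≤ h` on `[X, ∞)` with `x₀ < X`, and `g(r)·h(r′) ≤ B` whenever `x₀ < r ≤ r′` and `X ≤ r′`,
then `1 ≤ B` (let `r → x₀⁺` at fixed `r′`, then `r′ → ∞`). -/
private theorem one_le_of_kernelBound {g h u : ℝ → ℝ} {x₀ X B : ℝ} (hX : x₀ < X)
    (hg : Tendsto g (𝓝[>] x₀) (𝓝 1)) (hu : Tendsto u atTop (𝓝 1))
    (huh : ∀ t, X ≤ t → u t ≤ h t)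
    (hb : ∀ r r', x₀ < r → r ≤ r' → X ≤ r' → g r * h r' ≤ B) : 1 ≤ B := by
  -- `r → x₀⁺` at fixed `r'`
  have h3 : ∀ r', X ≤ r' → h r' ≤ B := by
    intro r' hr'
    have hlim : Tendsto (fun r ↦ g r * h r') (𝓝[>] x₀) (𝓝 (1 * h r')) := hg.mul_const (h r')
    rw [one_mul] at hlim
    refine le_of_tendsto hlim ?_
    filter_upwards [Ioo_mem_nhdsGT (hX.trans_le hr')] with r hr
    exact hb r r' hr.1 hr.2.le hr'
  -- `r' → ∞`
  refine le_of_tendsto hu ?_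
  filter_upwards [eventually_ge_atTop X] with t ht
  exact (huh t ht).trans (h3 t ht)

/-! ### The horizon normalisation as a limit -/

/-- **Horizon normalisation as a limit** (TdC Def. 2.3, `s = 0`): for `R` normalised at `𝓗⁺`,
`√(r²+a²)·‖R r‖ → 1` as `r → r₊⁺`. Indeed `R(r)·(r − r₊)^{0−ξ} = f(r)` on `(r₊, r₊ + ε)` with `f`
smooth (hence continuous) at `r₊` and `‖f(r₊)‖·√(r₊²+a²)·(r₊ − r₋)⁰ = 1`, while
`‖(r − r₊)^{0−ξ}‖ = (r − r₊)^{Re(0−ξ)} = 1` because `ξ = −i·(real)` is purely imaginary. -/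
private theorem tendsto_horizonNormalisation {M a ω m : ℝ} {R : ℝ → ℂ}
    (h : Kerr.IsNormalisedHorizonSolution M a 0 ω m R) :
    Tendsto (fun r ↦ Real.sqrt (r ^ 2 + a ^ 2) * ‖R r‖) (𝓝[>] Kerr.rPlus M a) (𝓝 1) := by
  obtain ⟨ε, hε, f, hf, hRf, hnorm⟩ := h
  rw [Real.rpow_zero, mul_one] at hnorm
  -- `f` is continuous at `r₊`
  have hcont : ContinuousAt f (Kerr.rPlus M a) :=
    (hf.continuousOn.continuousWithinAt ⟨by linarith, by linarith⟩).continuousAt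
      (Ioo_mem_nhds (by linarith) (by linarith))
  have hG : ContinuousAt (fun r ↦ Real.sqrt (r ^ 2 + a ^ 2) * ‖f r‖) (Kerr.rPlus M a) :=
    ((Real.continuous_sqrt.comp
      (show Continuous fun r : ℝ ↦ r ^ 2 + a ^ 2 by fun_prop)).continuousAt).mul hcont.norm
  have hval : Real.sqrt (Kerr.rPlus M a ^ 2 + a ^ 2) * ‖f (Kerr.rPlus M a)‖ = 1 := by
    rw [mul_comm]; exact hnorm
  have hlim : Tendsto (fun r ↦ Real.sqrt (r ^ 2 + a ^ 2) * ‖f r‖) (𝓝[>] Kerr.rPlus M a)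
      (𝓝 (Real.sqrt (Kerr.rPlus M a ^ 2 + a ^ 2) * ‖f (Kerr.rPlus M a)‖)) :=
    hG.tendsto.mono_left nhdsWithin_le_nhds
  rw [hval] at hlim
  -- and `√(r²+a²)‖f r‖ = √(r²+a²)‖R r‖` just to the right of `r₊`
  refine hlim.congr' ?_
  filter_upwards [Ioo_mem_nhdsGT (show Kerr.rPlus M a < Kerr.rPlus M a + ε by linarith)] with r hr
  rw [← hRf r hr, norm_mul, Complex.norm_cpow_eq_rpow_re_of_pos (sub_pos.2 hr.1),
    Complex.sub_re, Kerr.Costa2019.horizonExponent_re, Complex.ofReal_re, sub_zero,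
    Real.rpow_zero, mul_one]

/-! ### The infinity normalisation as a limit -/

-- adapted from Literature/Geometry/Lorentzian/TeukolskyRadialFluxInfinity.lean
/-- `t · t^{q} → 0` as `t → +∞` when `q < −1`. -/
private theorem tendsto_mul_rpow_of_lt_neg_one {q : ℝ} (hq : q < -1) :
    Tendsto (fun t : ℝ ↦ t * t ^ q) atTop (𝓝 0) := by
  refine (tendsto_rpow_neg_atTop (y := -(q + 1)) (by linarith)).congr' ?_
  filter_upwards [eventually_gt_atTop 0] with t ht
  rw [neg_neg, Real.rpow_add_one ht.ne', mul_comm]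

-- adapted from Literature/Geometry/Lorentzian/TeukolskyRadialFluxInfinity.lean
/-- `t · t^{q} → 0` in `ℂ` as `t → +∞` when `q < −1`. -/
private theorem tendsto_ofReal_mul_rpow_of_lt_neg_one {q : ℝ} (hq : q < -1) :
    Tendsto (fun t : ℝ ↦ (t : ℂ) * ((t ^ q : ℝ) : ℂ)) atTop (𝓝 0) := by
  have h := (tendsto_mul_rpow_of_lt_neg_one hq).ofReal
  rw [Complex.ofReal_zero] at h
  exact h.congr fun t ↦ by simp only [Complex.ofReal_mul]

-- adapted from Literature/Geometry/Lorentzian/TeukolskyRadialFluxInfinity.lean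
/-- `s = 0`: `t · π_N(t) = Σ_{k ≤ N} c_k t^{−k} → c₀` as `t → ∞` (`π_N = outgoingSum 0 c N`, the
amplitude partial sum of the expansion of TdC Def. 2.3). -/
private theorem tendsto_mul_outgoingSum_zero (c : ℕ → ℂ) (N : ℕ) :
    Tendsto (fun t : ℝ ↦ (t : ℂ) * Kerr.Costa2019.outgoingSum 0 c N t) atTop (𝓝 (c 0)) := by
  have e : ∀ k : ℕ, (-(2 * (0 : ℝ)) - (k : ℝ) - 1) = -(k : ℝ) - 1 := fun k ↦ by ring
  simp only [Kerr.Costa2019.outgoingSum, e, Finset.mul_sum]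
  have h0 : Tendsto (fun t : ℝ ↦ (t : ℂ) * (c 0 * ((t ^ (-((0 : ℕ) : ℝ) - 1) : ℝ) : ℂ))) atTop
      (𝓝 (c 0)) := by
    refine tendsto_const_nhds.congr' ?_
    filter_upwards [eventually_gt_atTop 0] with t ht
    have ht' : (t : ℂ) ≠ 0 := by exact_mod_cast ht.ne'
    rw [Nat.cast_zero, neg_zero, zero_sub, Real.rpow_neg_one, Complex.ofReal_inv, mul_left_comm,
      mul_inv_cancel₀ ht', mul_one]
  have h1 : ∀ k ∈ Finset.range N, Tendsto (fun t : ℝ ↦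
      (t : ℂ) * (c (k + 1) * ((t ^ (-((k + 1 : ℕ) : ℝ) - 1) : ℝ) : ℂ))) atTop (𝓝 0) := by
    intro k _
    have hq : (-((k + 1 : ℕ) : ℝ) - 1) < -1 := by
      have : (0 : ℝ) ≤ k := Nat.cast_nonneg k
      push_cast; linarith
    have h := (tendsto_ofReal_mul_rpow_of_lt_neg_one hq).const_mul (c (k + 1))
    rw [mul_zero] at h
    exact h.congr fun t ↦ by ring
  have h := (tendsto_finsetSum _ h1).add h0
  simp only [Finset.sum_const_zero, zero_add] at h
  exact h.congr fun t ↦ (Finset.sum_range_succ' _ _).symm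

/-- **Infinity normalisation as a limit** (TdC Def. 2.3, `s = 0`): for `R` normalised at `𝓘⁺`,
`r·‖R r‖ → 1` as `r → ∞`. With `N = 1`: `‖R − Φ·(c₀r⁻¹ + c₁r⁻²)‖ ≤ C r⁻³` far out, the phase
`Φ = e^{iωr + 2iMω log r}` is unimodular and `r·(c₀r⁻¹ + c₁r⁻²) → c₀` with `‖c₀‖ = 1`. -/
private theorem tendsto_infinityNormalisation {M ω : ℝ} {R : ℝ → ℂ}
    (h : Kerr.IsNormalisedInfinitySolution M 0 ω R) :
    Tendsto (fun t : ℝ ↦ t * ‖R t‖) atTop (𝓝 1) := by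
  obtain ⟨c, hc0, hN⟩ := h
  obtain ⟨C, r₀, hB⟩ := hN 1 le_rfl
  -- the `N = 1` remainder bound, with the comparison function `outgoingP M 0 ω c 1`
  have hB' : ∀ t, r₀ ≤ t → ‖R t - Kerr.Costa2019.outgoingP M 0 ω c 1 t‖ ≤ C * t ^ (-(3 : ℝ)) := by
    intro t ht
    have hb := hB t ht
    have e1 : (-(2 * (0 : ℝ)) - ((1 : ℕ) : ℝ) - 2 : ℝ) = -(3 : ℝ) := by norm_num
    rw [e1] at hb
    exact hb
  -- `‖t · π₁(t)‖ → ‖c₀‖ = 1`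
  have hv : Tendsto (fun t : ℝ ↦ ‖(t : ℂ) * Kerr.Costa2019.outgoingSum 0 c 1 t‖) atTop (𝓝 1) := by
    rw [← hc0]
    exact (tendsto_mul_outgoingSum_zero c 1).norm
  -- the difference is `O(t⁻²)`
  have hdiff : Tendsto (fun t : ℝ ↦ t * ‖R t‖ - ‖(t : ℂ) * Kerr.Costa2019.outgoingSum 0 c 1 t‖)
      atTop (𝓝 0) := by
    have hq : (-(3 : ℝ)) < -1 := by norm_num
    have hg := (tendsto_mul_rpow_of_lt_neg_one hq).const_mul C
    rw [mul_zero] at hg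
    refine squeeze_zero_norm' ?_ hg
    filter_upwards [eventually_ge_atTop r₀, eventually_gt_atTop 0] with t ht ht0
    have e2 : t * ‖R t‖ = ‖(t : ℂ) * R t‖ := by
      rw [norm_mul, Complex.norm_of_nonneg ht0.le]
    have e3 : ‖(t : ℂ) * Kerr.Costa2019.outgoingSum 0 c 1 t‖ =
        ‖(t : ℂ) * Kerr.Costa2019.outgoingP M 0 ω c 1 t‖ := by
      simp only [Kerr.Costa2019.outgoingP, norm_mul, Kerr.Costa2019.norm_outgoingPhase, one_mul]
    rw [Real.norm_eq_abs, e2, e3]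
    calc |‖(t : ℂ) * R t‖ - ‖(t : ℂ) * Kerr.Costa2019.outgoingP M 0 ω c 1 t‖|
        ≤ ‖(t : ℂ) * R t - (t : ℂ) * Kerr.Costa2019.outgoingP M 0 ω c 1 t‖ :=
          abs_norm_sub_norm_le _ _
      _ = t * ‖R t - Kerr.Costa2019.outgoingP M 0 ω c 1 t‖ := by
          rw [← mul_sub, norm_mul, Complex.norm_of_nonneg ht0.le]
      _ ≤ t * (C * t ^ (-(3 : ℝ))) := mul_le_mul_of_nonneg_left (hB' t ht) ht0.le
      _ = C * (t * t ^ (-(3 : ℝ))) := by ring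
  have hsum := hdiff.add hv
  rw [zero_add] at hsum
  exact hsum.congr fun t ↦ by ring

/-! ### The stub -/

/-- **S4′ · `stub_wronskianOfKernel` — the Wronskian bound is the END-POINT case of the kernel
bound.** From the kernel bound on windows of blown-up depth `≥ θ` (hypothesis) follows, with the
same constants at `θ = 1`: for `M > 0` there are `a₁ < M`, `ε₀ > 0`, `C > 0`, `N` with
`1 ≤ (C|m|^N κ^{-N})²|𝔚(r)|²` at every `r > r₊` for all cone frequencies and all normalised pairs.
Proof: `𝔚` is constant in `r` (`Kerr.Costa2019.radialWronskian_eq`), `√(r²+a²)‖R_𝓗 r‖ → 1` as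
`r → r₊⁺` (`tendsto_horizonNormalisation`), `r′‖R_𝓘 r′‖ → 1` as `r′ → ∞`
(`tendsto_infinityNormalisation`) and `r′ ≤ √(r′²+a²)`; so the kernel bound at `(r, r′)` with
`r → r₊⁺` and then `r′ → ∞` gives `1 ≤ C|m|^N κ^{-N}‖𝔚(r₀)‖`, hence `1 ≤ (C|m|^N κ^{-N})²‖𝔚(r₀)‖²`. -/
theorem stub_wronskianOfKernel :
    (∀ M : ℝ, 0 < M → ∀ θ : ℝ, 0 < θ → ∃ (a₁ ε₀ C : ℝ) (N : ℕ), a₁ < M ∧ 0 < ε₀ ∧ 0 < C ∧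
      ∀ a : ℝ, a₁ ≤ |a| → Kerr.IsSubextremal M a →
        ∀ (ω : ℝ) (m : ℤ) (Λ : ℝ), Kerr.IsAdmissibleTriple a ω m Λ → m ≠ 0 →
          |ω - m * Kerr.horizonAngularVelocity M a| ≤ ε₀ * |(m : ℝ)| →
            ∀ RH RI : ℝ → ℂ,
              Kerr.IsRadialTeukolskySolution M a 0 ω m (Λ - a ^ 2 * ω ^ 2) RH →
              Kerr.IsNormalisedHorizonSolution M a 0 ω m RH →
              Kerr.IsRadialTeukolskySolution M a 0 ω m (Λ - a ^ 2 * ω ^ 2) RI →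
              Kerr.IsNormalisedInfinitySolution M 0 ω RI →
                ∀ r r' : ℝ, Kerr.rPlus M a < r → r ≤ r' →
                  Kerr.rPlus M a + θ * (Kerr.rPlus M a - Kerr.rMinus M a) ≤ r' →
                    Real.sqrt (r ^ 2 + a ^ 2) * ‖RH r‖ * (Real.sqrt (r' ^ 2 + a ^ 2) * ‖RI r'‖) ≤
                      C * |(m : ℝ)| ^ N * (Kerr.surfaceGravity M a)⁻¹ ^ N * ‖Kerr.radialWronskian M a 0 RH RI r‖) →
    (∀ M : ℝ, 0 < M → ∃ (a₁ ε₀ C : ℝ) (N : ℕ), a₁ < M ∧ 0 < ε₀ ∧ 0 < C ∧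
      ∀ a : ℝ, a₁ ≤ |a| → Kerr.IsSubextremal M a →
        ∀ (ω : ℝ) (m : ℤ) (Λ : ℝ), Kerr.IsAdmissibleTriple a ω m Λ → m ≠ 0 →
          |ω - m * Kerr.horizonAngularVelocity M a| ≤ ε₀ * |(m : ℝ)| →
            ∀ RH RI : ℝ → ℂ,
              Kerr.IsRadialTeukolskySolution M a 0 ω m (Λ - a ^ 2 * ω ^ 2) RH →
              Kerr.IsNormalisedHorizonSolution M a 0 ω m RH →
              Kerr.IsRadialTeukolskySolution M a 0 ω m (Λ - a ^ 2 * ω ^ 2) RI →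
              Kerr.IsNormalisedInfinitySolution M 0 ω RI →
                ∀ r : ℝ, Kerr.rPlus M a < r →
                  1 ≤ (C * |(m : ℝ)| ^ N * (Kerr.surfaceGravity M a)⁻¹ ^ N) ^ 2 *
                    ‖Kerr.radialWronskian M a 0 RH RI r‖ ^ 2) := by
  intro hK M hM
  -- the kernel bound with collar parameter `θ = 1`; keep its constants
  obtain ⟨a₁, ε₀, C, N, ha₁, hε₀, hC, hKer⟩ := hK M hM 1 one_pos
  refine ⟨a₁, ε₀, C, N, ha₁, hε₀, hC, ?_⟩
  intro a ha hsub ω m Λ hadm hm hcone RH RI hH hnH hI hnI r₀ hr₀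
  have ha' : |a| < M := hsub
  have hd : 0 < Kerr.rPlus M a - Kerr.rMinus M a := sub_pos.2 hsub.rMinus_lt_rPlus
  have hX : Kerr.rPlus M a < Kerr.rPlus M a + 1 * (Kerr.rPlus M a - Kerr.rMinus M a) := by
    linarith
  -- `1 ≤ C|m|^N κ^{-N} ‖𝔚(r₀)‖` by the two end-point limits and the constancy of `𝔚`
  have hkey : 1 ≤ C * |(m : ℝ)| ^ N * (Kerr.surfaceGravity M a)⁻¹ ^ N *
      ‖Kerr.radialWronskian M a 0 RH RI r₀‖ := by
    refine one_le_of_kernelBound (h := fun r' ↦ Real.sqrt (r' ^ 2 + a ^ 2) * ‖RI r'‖) hX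
      (tendsto_horizonNormalisation hnH) (tendsto_infinityNormalisation hnI)
      (fun t _ ↦ ?_) (fun r r' hr hrr' hr' ↦ ?_)
    · exact mul_le_mul_of_nonneg_right
        (Real.le_sqrt_of_sq_le (le_add_of_nonneg_right (sq_nonneg a))) (norm_nonneg _)
    · have hb := hKer a ha hsub ω m Λ hadm hm hcone RH RI hH hnH hI hnI r r' hr hrr' hr'
      rwa [Kerr.Costa2019.radialWronskian_eq ha'.le hH hI hr hr₀] at hb
  calc (1 : ℝ) ≤ (C * |(m : ℝ)| ^ N * (Kerr.surfaceGravity M a)⁻¹ ^ N *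
        ‖Kerr.radialWronskian M a 0 RH RI r₀‖) ^ 2 := one_le_pow₀ hkey
    _ = (C * |(m : ℝ)| ^ N * (Kerr.surfaceGravity M a)⁻¹ ^ N) ^ 2 *
        ‖Kerr.radialWronskian M a 0 RH RI r₀‖ ^ 2 := mul_pow _ _ 2

end Summit.FinalStateConjecture.FinalStateConjecture.Theorems.KappaExplicitWaveDecay.OlverDunsterUniformReduction

end
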